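import Mathlib
import Literature.NumberTheory.LFunctions.MatomakiRadziwillTaoTheorem13
import Literature.NumberTheory.LFunctions.TaoLogElliottProp24

/-!
# `QuadraticDigitPhases` (stmt-QuantumAdvantage-1391), line `Sketch` — stub `stub_momoAP`, the block lemma

Step 1 of the almost-periodic sub-branch of the banded branch: from Matomäki–Radziwiłł–Tao 2015,
Theorem 1.3 (the tree's `Literature.NumberTheory.LFunctions.Tao2016.MatomakiRadziwillTao2015_theorem13`,
taken as a hypothesis) the dyadic block statistic of `λ(m) e(αm)` is small uniformly in `α`:
for every `δ > 0`, eventually in `k` and then eventually in `n`,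
`Σ_{b < 2^{n-k}} |Σ_{a < 2^k} λ(2^k b + a) e(α (2^k b + a))| ≤ δ 2^n` for all real `α`
(`liouville_phase_blocks`).

Proof. Write `H = 2^k`, `N = 2^n`, `F(m) = λ(m) e(αm)` and `S(m) = Σ_{i<H} F(m+i)`. For integer `H`
the MRT integrand `x ↦ |Σ_{x ≤ m ≤ x+H} F(m)|` is a step function, equal to `|S(m+1)|` on `(m, m+1)`,
so `∫_0^N |Σ_{x ≤ m ≤ x+H} F(m)| dx = Σ_{m<N} |S(m+1)|` (`integral_window_eq_sum`), which Theorem 1.3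
bounds by `C (log log H / log H + log^{-1/700} N) H N`. Shifting a window by `t` costs `2t`
(`norm_window_shift_le`), so averaging over the `J` windows ending just before each block,
`J Σ_{b<B} |S(bH)| ≤ J H + Σ_{m<N} |S(m+1)| + 2 J² B` (`sum_blocks_le`, `B = N/H`); with
`J = ⌊δH/8⌋` this is `≤ J δ N` once `log log H / log H` and `log^{-1/700} N` are below `δ²/(64C)`
and `H ≤ δN/4`.
-/

set_option linter.dupNamespace false -- D-0017: single-problem summit ⇒ `QuantumAdvantage.QuantumAdvantage` by design

namespace Summit.QuantumAdvantage.QuantumAdvantage.Theorems.MobiusLadderQuadraticDigitPhasesStubMomoAPBlocks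

open Finset Filter MeasureTheory
open Literature.NumberTheory.LFunctions

/-! ### Blocks and windows of consecutive integers -/

/-- Splitting `range (H·B)` into `B` blocks of `H` consecutive integers:
`Σ_{m < HB} φ(m) = Σ_{b<B} Σ_{a<H} φ(Hb + a)`. [folklore] -/
theorem sum_range_mul_eq_sum_sum {M : Type*} [AddCommMonoid M] (φ : ℕ → M) (H B : ℕ) :
    ∑ m ∈ range (H * B), φ m = ∑ b ∈ range B, ∑ a ∈ range H, φ (H * b + a) := by
  -- adapted from `Literature.NumberTheory.LFunctions.sum_range_mul_eq_sum_sum` (MoebiusWalshResonance)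
  induction B with
  | zero => simp
  | succ B ih => rw [Finset.sum_range_succ, ← ih, Nat.mul_succ, Finset.sum_range_add]

/-- Shifting a window of length `H` of a `1`-bounded sequence by `t` changes its sum by at most
`2t` in norm: `|Σ_{i<H} F(m+t+i)| ≤ |Σ_{i<H} F(m+i)| + 2t`. [folklore] -/
theorem norm_window_shift_le {F : ℕ → ℂ} (hF : ∀ m, ‖F m‖ ≤ 1) (H m t : ℕ) :
    ‖∑ i ∈ range H, F (m + t + i)‖ ≤ ‖∑ i ∈ range H, F (m + i)‖ + 2 * t := by
  induction t with
  | zero => simp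
  | succ t ih =>
    have h1 : ∑ i ∈ range (H + 1), F (m + t + i) = ∑ i ∈ range H, F (m + t + i) + F (m + t + H) :=
      Finset.sum_range_succ _ _
    have h2 : ∑ i ∈ range (H + 1), F (m + t + i) =
        ∑ i ∈ range H, F (m + (t + 1) + i) + F (m + t) := by
      rw [Finset.sum_range_succ', add_zero]
      congr 1
      exact Finset.sum_congr rfl fun i _ => by rw [show m + t + (i + 1) = m + (t + 1) + i by ring]
    have h3 : ∑ i ∈ range H, F (m + (t + 1) + i) =
        ∑ i ∈ range H, F (m + t + i) + (F (m + t + H) - F (m + t)) := by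
      linear_combination h1 - h2
    rw [h3]
    calc ‖∑ i ∈ range H, F (m + t + i) + (F (m + t + H) - F (m + t))‖
        ≤ ‖∑ i ∈ range H, F (m + t + i)‖ + ‖F (m + t + H) - F (m + t)‖ := norm_add_le _ _
      _ ≤ (‖∑ i ∈ range H, F (m + i)‖ + 2 * t) + (1 + 1) :=
          add_le_add ih ((norm_sub_le _ _).trans (add_le_add (hF _) (hF _)))
      _ = ‖∑ i ∈ range H, F (m + i)‖ + 2 * ((t + 1 : ℕ) : ℝ) := by push_cast; ring

/-! ### The Matomäki–Radziwiłł–Tao integrand is a step function for integer `H` -/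

/-- On `(m, m+1)` the window sum over the integers of `[y, y+H]` is `Σ_{i<H} F(m+1+i)` (the
integers of `[y, y+H]` are `m+1, …, m+H`, `Literature.NumberTheory.LFunctions.Tao2016.Icc_ceil_floor_eq`).
[folklore] -/
theorem window_sum_eq_of_mem_Ioo (F : ℕ → ℂ) (H : ℕ) {m : ℕ} {y : ℝ}
    (hy : y ∈ Set.Ioo (m : ℝ) (m + 1)) :
    ∑ n ∈ Icc ⌈y⌉₊ ⌊y + (H : ℝ)⌋₊, F n = ∑ i ∈ range H, F (m + 1 + i) := by
  rw [Tao2016.Icc_ceil_floor_eq hy, ← Finset.Ico_add_one_right_eq_Icc, Finset.sum_Ico_eq_sum_range,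
    show m + H + 1 - (m + 1) = H by omega]

/-- The integral of the MRT integrand `y ↦ |Σ_{y ≤ n ≤ y+H} F(n)|` over `[m, m+1]` is
`|Σ_{i<H} F(m+1+i)|`, and the integrand is interval integrable there. [folklore] -/
theorem integral_window_unit (F : ℕ → ℂ) (H m : ℕ) :
    IntervalIntegrable (fun y : ℝ => ‖∑ n ∈ Icc ⌈y⌉₊ ⌊y + (H : ℝ)⌋₊, F n‖) volume (m : ℝ) ((m : ℝ) + 1) ∧
      ∫ y in (m : ℝ)..((m : ℝ) + 1), ‖∑ n ∈ Icc ⌈y⌉₊ ⌊y + (H : ℝ)⌋₊, F n‖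
        = ‖∑ i ∈ range H, F (m + 1 + i)‖ := by
  -- adapted from `Literature.NumberTheory.LFunctions.Tao2016.integral_mrtIntegrand_unit` (TaoLogElliottProp24)
  have hle : (m : ℝ) ≤ m + 1 := by linarith
  have hae : (fun y : ℝ => ‖∑ n ∈ Icc ⌈y⌉₊ ⌊y + (H : ℝ)⌋₊, F n‖)
      =ᵐ[volume.restrict (Set.Ioc (m : ℝ) (m + 1))] fun _ => ‖∑ i ∈ range H, F (m + 1 + i)‖ := by
    rw [← Measure.restrict_congr_set (Ioo_ae_eq_Ioc (μ := volume) (a := (m : ℝ)) (b := m + 1))]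
    rw [Filter.EventuallyEq, ae_restrict_iff' measurableSet_Ioo]
    exact Filter.Eventually.of_forall fun y hy => by
      show ‖_‖ = ‖_‖
      rw [window_sum_eq_of_mem_Ioo F H hy]
  have hint : IntegrableOn (fun y : ℝ => ‖∑ n ∈ Icc ⌈y⌉₊ ⌊y + (H : ℝ)⌋₊, F n‖)
      (Set.Ioc (m : ℝ) (m + 1)) volume := by
    refine IntegrableOn.congr_fun_ae ?_ hae.symm
    exact integrableOn_const (by rw [Real.volume_Ioc]; exact ENNReal.ofReal_ne_top)
  refine ⟨?_, ?_⟩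
  · rw [intervalIntegrable_iff, Set.uIoc_of_le hle]
    exact hint
  · rw [intervalIntegral.integral_of_le hle, integral_congr_ae hae, setIntegral_const,
      Real.volume_real_Ioc, smul_eq_mul]
    have : max ((m : ℝ) + 1 - m) 0 = 1 := by rw [max_eq_left (by linarith)]; ring
    rw [this, one_mul]

/-- **The MRT integral as a sum over integers** (integer `H`):
`∫_0^N |Σ_{y ≤ n ≤ y+H} F(n)| dy = Σ_{m<N} |Σ_{i<H} F(m+1+i)|`. [folklore] -/
theorem integral_window_eq_sum (F : ℕ → ℂ) (H N : ℕ) :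
    ∫ y in (0 : ℝ)..(N : ℝ), ‖∑ n ∈ Icc ⌈y⌉₊ ⌊y + (H : ℝ)⌋₊, F n‖
      = ∑ m ∈ range N, ‖∑ i ∈ range H, F (m + 1 + i)‖ := by
  -- adapted from `Literature.NumberTheory.LFunctions.Tao2016.sum_norm_shortExpSum_eq_integral`
  have h := intervalIntegral.sum_integral_adjacent_intervals
    (f := fun y : ℝ => ‖∑ n ∈ Icc ⌈y⌉₊ ⌊y + (H : ℝ)⌋₊, F n‖)
    (μ := volume) (a := fun k : ℕ => (k : ℝ)) (n := N)
    (fun k _ => by exact_mod_cast (integral_window_unit F H k).1)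
  push_cast at h
  rw [← h]
  exact Finset.sum_congr rfl fun m _ => (integral_window_unit F H m).2

/-! ### Blocks versus sliding windows -/

/-- One block versus the `J` windows ending inside the previous block: for `J < H`,
`J |S(H(c+1))| ≤ Σ_{a<H} |S(Hc + a + 1)| + 2J²`, where `S(m) = Σ_{i<H} F(m+i)` and `|F| ≤ 1`.
[folklore] -/
theorem block_le_windows {F : ℕ → ℂ} (hF : ∀ m, ‖F m‖ ≤ 1) {H J : ℕ} (hJH : J < H) (c : ℕ) :
    (J : ℝ) * ‖∑ i ∈ range H, F (H * (c + 1) + i)‖ ≤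
      ∑ a ∈ range H, ‖∑ i ∈ range H, F (H * c + a + 1 + i)‖ + 2 * (J : ℝ) ^ 2 := by
  -- `H = J + 1 + R`; the window `j < J` starts at `Hc + (R + j) + 1`; shifted by `J - j` it is the block
  obtain ⟨R, hR⟩ : ∃ R, H = J + 1 + R := ⟨H - 1 - J, by omega⟩
  have hwin : ∀ j ∈ range J, ‖∑ i ∈ range H, F (H * (c + 1) + i)‖ ≤
      ‖∑ i ∈ range H, F (H * c + (R + j) + 1 + i)‖ + 2 * J := by
    intro j hj
    rw [Finset.mem_range] at hj
    have h := norm_window_shift_le hF H (H * c + (R + j) + 1) (J - j)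
    have heq : H * c + (R + j) + 1 + (J - j) = H * (c + 1) := by
      rw [Nat.mul_succ]; omega
    rw [heq] at h
    refine h.trans ?_
    have : ((J - j : ℕ) : ℝ) ≤ J := by exact_mod_cast Nat.sub_le J j
    linarith
  calc (J : ℝ) * ‖∑ i ∈ range H, F (H * (c + 1) + i)‖
      = ∑ j ∈ range J, ‖∑ i ∈ range H, F (H * (c + 1) + i)‖ := by
        rw [Finset.sum_const, Finset.card_range, nsmul_eq_mul]
    _ ≤ ∑ j ∈ range J, (‖∑ i ∈ range H, F (H * c + (R + j) + 1 + i)‖ + 2 * (J : ℝ)) :=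
        Finset.sum_le_sum hwin
    _ = ∑ j ∈ range J, ‖∑ i ∈ range H, F (H * c + (R + j) + 1 + i)‖ + 2 * (J : ℝ) ^ 2 := by
        rw [Finset.sum_add_distrib, Finset.sum_const, Finset.card_range, nsmul_eq_mul]; ring
    _ = ∑ a ∈ Ico R (R + J), ‖∑ i ∈ range H, F (H * c + a + 1 + i)‖ + 2 * (J : ℝ) ^ 2 := by
        rw [Finset.sum_Ico_eq_sum_range, show R + J - R = J by omega]
    _ ≤ ∑ a ∈ range H, ‖∑ i ∈ range H, F (H * c + a + 1 + i)‖ + 2 * (J : ℝ) ^ 2 := by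
        refine add_le_add ?_ le_rfl
        apply Finset.sum_le_sum_of_subset_of_nonneg
        · intro a ha
          rw [Finset.mem_Ico] at ha
          rw [Finset.mem_range]
          omega
        · exact fun _ _ _ => norm_nonneg _

/-- **Blocks versus sliding windows.** For a `1`-bounded `F`, `J < H` and any `B`,
`J Σ_{b<B} |S(Hb)| ≤ J H + Σ_{m<HB} |S(m+1)| + 2J²B` (`S(m) = Σ_{i<H} F(m+i)`): the block `b = 0`
is bounded trivially and every other block by the average of the `J` windows before it. [folklore] -/
theorem sum_blocks_le {F : ℕ → ℂ} (hF : ∀ m, ‖F m‖ ≤ 1) {H J : ℕ} (hJH : J < H) (B : ℕ) :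
    (J : ℝ) * ∑ b ∈ range B, ‖∑ i ∈ range H, F (H * b + i)‖ ≤
      (J : ℝ) * H + ∑ m ∈ range (H * B), ‖∑ i ∈ range H, F (m + 1 + i)‖
        + 2 * (J : ℝ) ^ 2 * B := by
  have hS0 : ∀ m, ‖∑ i ∈ range H, F (m + i)‖ ≤ H := fun m =>
    (norm_sum_le _ _).trans (by
      calc ∑ i ∈ range H, ‖F (m + i)‖ ≤ ∑ i ∈ range H, (1 : ℝ) := Finset.sum_le_sum fun i _ => hF _
        _ = H := by simp)
  cases B with
  | zero =>
    simp only [Finset.range_zero, Finset.sum_empty, mul_zero, Nat.cast_zero, add_zero]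
    positivity
  | succ B' =>
    rw [Finset.sum_range_succ', mul_add]
    have hblocks : (J : ℝ) * ∑ c ∈ range B', ‖∑ i ∈ range H, F (H * (c + 1) + i)‖ ≤
        ∑ m ∈ range (H * (B' + 1)), ‖∑ i ∈ range H, F (m + 1 + i)‖
          + 2 * (J : ℝ) ^ 2 * ((B' + 1 : ℕ) : ℝ) := by
      rw [Finset.mul_sum]
      calc ∑ c ∈ range B', (J : ℝ) * ‖∑ i ∈ range H, F (H * (c + 1) + i)‖
          ≤ ∑ c ∈ range B',
              (∑ a ∈ range H, ‖∑ i ∈ range H, F (H * c + a + 1 + i)‖ + 2 * (J : ℝ) ^ 2) :=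
            Finset.sum_le_sum fun c _ => block_le_windows hF hJH c
        _ = ∑ c ∈ range B', ∑ a ∈ range H, ‖∑ i ∈ range H, F (H * c + a + 1 + i)‖
              + 2 * (J : ℝ) ^ 2 * B' := by
            rw [Finset.sum_add_distrib, Finset.sum_const, Finset.card_range, nsmul_eq_mul]; ring
        _ ≤ ∑ c ∈ range (B' + 1), ∑ a ∈ range H, ‖∑ i ∈ range H, F (H * c + a + 1 + i)‖
              + 2 * (J : ℝ) ^ 2 * ((B' + 1 : ℕ) : ℝ) := by
            refine add_le_add (Finset.sum_le_sum_of_subset_of_nonneg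
              (Finset.range_subset_range.2 (Nat.le_succ B'))
              (fun _ _ _ => Finset.sum_nonneg fun _ _ => norm_nonneg _)) ?_
            exact mul_le_mul_of_nonneg_left (by exact_mod_cast Nat.le_succ B') (by positivity)
        _ = ∑ m ∈ range (H * (B' + 1)), ‖∑ i ∈ range H, F (m + 1 + i)‖
              + 2 * (J : ℝ) ^ 2 * ((B' + 1 : ℕ) : ℝ) := by
            rw [sum_range_mul_eq_sum_sum (fun m => ‖∑ i ∈ range H, F (m + 1 + i)‖) H (B' + 1)]
    have h0 : (J : ℝ) * ‖∑ i ∈ range H, F (H * 0 + i)‖ ≤ J * H :=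
      mul_le_mul_of_nonneg_left (hS0 _) (Nat.cast_nonneg J)
    linarith [hblocks, h0]

/-! ### The block lemma -/

/-- `λ(m) e(αm)` is `1`-bounded. [folklore] -/
theorem norm_liouville_mul_e_le (α : ℝ) (m : ℕ) :
    ‖((ArithmeticFunction.liouville m : ℤ) : ℂ) * VdC.e (α * m)‖ ≤ 1 := by
  rw [norm_mul, VdC.norm_e, mul_one, ← ArithmeticFunction.intCoe_apply]
  exact norm_liouville_complex_le_one m

/-- The thresholds in `k`: eventually `16 ≤ 2^k`, `16/δ ≤ 2^k` and
`log log 2^k / log 2^k ≤ η` (`log log x / log x → 0`). [folklore] -/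
theorem eventually_k {δ η : ℝ} (hη : 0 < η) :
    ∀ᶠ k : ℕ in atTop, (16 : ℝ) ≤ ((2 ^ k : ℕ) : ℝ) ∧ 16 / δ ≤ ((2 ^ k : ℕ) : ℝ) ∧
      Real.log (Real.log ((2 ^ k : ℕ) : ℝ)) / Real.log ((2 ^ k : ℕ) : ℝ) ≤ η := by
  have h2 : Tendsto (fun k : ℕ => ((2 ^ k : ℕ) : ℝ)) atTop atTop :=
    tendsto_natCast_atTop_atTop.comp (tendsto_pow_atTop_atTop_of_one_lt one_lt_two)
  refine (h2.eventually_ge_atTop 16).and ((h2.eventually_ge_atTop _).and ?_)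
  have h3 : Tendsto (fun x : ℝ => Real.log x / x) atTop (nhds 0) :=
    Real.isLittleO_log_id_atTop.tendsto_div_nhds_zero
  have h4 : Tendsto (fun k : ℕ => Real.log (Real.log ((2 ^ k : ℕ) : ℝ)) / Real.log ((2 ^ k : ℕ) : ℝ))
      atTop (nhds 0) :=
    h3.comp (Real.tendsto_log_atTop.comp h2)
  exact h4.eventually_le_const hη

/-- The thresholds in `n` (given `k` and a constant `c`): eventually `k ≤ n`, `c ≤ 2^n` and
`log^{-1/700} 2^n ≤ η`. [folklore] -/
theorem eventually_n (k : ℕ) (c : ℝ) {η : ℝ} (hη : 0 < η) :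
    ∀ᶠ n : ℕ in atTop, k ≤ n ∧ c ≤ ((2 ^ n : ℕ) : ℝ) ∧
      1 / Real.log ((2 ^ n : ℕ) : ℝ) ^ (1 / 700 : ℝ) ≤ η := by
  have h2 : Tendsto (fun n : ℕ => ((2 ^ n : ℕ) : ℝ)) atTop atTop :=
    tendsto_natCast_atTop_atTop.comp (tendsto_pow_atTop_atTop_of_one_lt one_lt_two)
  refine (eventually_ge_atTop k).and ((h2.eventually_ge_atTop c).and ?_)
  have h3 : Tendsto (fun n : ℕ => Real.log ((2 ^ n : ℕ) : ℝ) ^ (1 / 700 : ℝ)) atTop atTop :=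
    (tendsto_rpow_atTop (by norm_num)).comp (Real.tendsto_log_atTop.comp h2)
  filter_upwards [h3.eventually_ge_atTop (1 / η), h3.eventually_ge_atTop 1] with n hn hn1
  rw [one_div_le (by linarith) hη]
  exact hn

/-- **Block lemma** (Step 1 of stub `stub_momoAP`): from Matomäki–Radziwiłł–Tao 2015, Theorem 1.3,
for every `δ > 0`, eventually in `k` and then eventually in `n`, uniformly in `α ∈ ℝ`,
`Σ_{b<2^{n-k}} |Σ_{a<2^k} λ(2^k b + a) e(α(2^k b + a))| ≤ δ 2^n`: the discretised MRT integral
(`integral_window_eq_sum`) controls the sliding windows, and the blocks are within `2J` of the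
average of the `J = ⌊δ 2^k/8⌋` windows preceding them (`sum_blocks_le`).
[cite: MatomakiRadziwillTao2015, Theorem 1.3] -/
theorem liouville_phase_blocks (hMRT : Tao2016.MatomakiRadziwillTao2015_theorem13) {δ : ℝ}
    (hδ : 0 < δ) :
    ∀ᶠ k : ℕ in atTop, ∀ᶠ n : ℕ in atTop, ∀ α : ℝ,
      ∑ b ∈ range (2 ^ (n - k)),
        ‖∑ a ∈ range (2 ^ k), ((ArithmeticFunction.liouville (2 ^ k * b + a) : ℤ) : ℂ) *
          VdC.e (α * ((2 ^ k * b + a : ℕ) : ℝ))‖ ≤ δ * (2 : ℝ) ^ n := by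
  obtain ⟨C, hC⟩ := hMRT
  set C' : ℝ := max C 1 with hC'
  have hC'1 : 1 ≤ C' := le_max_right _ _
  have hCC' : C ≤ C' := le_max_left _ _
  set δ' : ℝ := min δ 1 with hδ'
  have hδ'0 : 0 < δ' := lt_min hδ one_pos
  have hδ'1 : δ' ≤ 1 := min_le_right _ _
  have hδ'δ : δ' ≤ δ := min_le_left _ _
  set η : ℝ := δ' ^ 2 / (64 * C') with hη
  have hη0 : 0 < η := by positivity
  filter_upwards [eventually_k (δ := δ') hη0] with k hk
  obtain ⟨hk16, hkδ, hkη⟩ := hk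
  filter_upwards [eventually_n k (4 * ((2 ^ k : ℕ) : ℝ) / δ') hη0] with n hn α
  obtain ⟨hkn, hnδ, hnη⟩ := hn
  -- the three scales `H = 2^k`, `N = 2^n`, `B = N / H`
  set H : ℕ := 2 ^ k with hHdef
  set N : ℕ := 2 ^ n with hNdef
  set B : ℕ := 2 ^ (n - k) with hBdef
  have hHB : H * B = N := by rw [hHdef, hBdef, hNdef, ← pow_add, Nat.add_sub_of_le hkn]
  have hNreal : (N : ℝ) = (2 : ℝ) ^ n := by rw [hNdef]; push_cast; ring
  have hBreal : (H : ℝ) * B = N := by exact_mod_cast hHB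
  have hH0 : (0 : ℝ) < H := by linarith
  have hN0 : (0 : ℝ) ≤ N := Nat.cast_nonneg N
  -- the window count `J`
  set J : ℕ := ⌊δ' * H / 8⌋₊ with hJdef
  have hδH : 16 ≤ δ' * H := by
    rw [div_le_iff₀ hδ'0] at hkδ; linarith
  have hJle : (J : ℝ) ≤ δ' * H / 8 := Nat.floor_le (by positivity)
  have hJge : δ' * H / 16 ≤ J := by
    have := Nat.lt_floor_add_one (δ' * H / 8)
    linarith
  have hJpos : (0 : ℝ) < J := by linarith
  have hJH : J < H := by
    have : (J : ℝ) < H := by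
      calc (J : ℝ) ≤ δ' * H / 8 := hJle
        _ ≤ 1 * H / 8 := by gcongr
        _ < H := by linarith
    exact_mod_cast this
  -- Theorem 1.3, discretised
  have h10 : (10 : ℝ) ≤ (H : ℝ) := by linarith
  have hHN : (H : ℝ) ≤ N := by
    have : H ≤ N := by rw [hHdef, hNdef]; exact Nat.pow_le_pow_right two_pos hkn
    exact_mod_cast this
  have hI : ∑ m ∈ range N, ‖∑ i ∈ range H,
      ((ArithmeticFunction.liouville (m + 1 + i) : ℤ) : ℂ) * VdC.e (α * ((m + 1 + i : ℕ) : ℝ))‖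
      ≤ C * (Real.log (Real.log H) / Real.log H + 1 / (Real.log N) ^ (1 / 700 : ℝ)) * H * N :=
    (integral_window_eq_sum
      (fun m => ((ArithmeticFunction.liouville m : ℤ) : ℂ) * VdC.e (α * m)) H N).symm.trans_le
      (hC (H : ℝ) (N : ℝ) h10 hHN α)
  have hlogH1 : 1 ≤ Real.log (H : ℝ) := by
    rw [← Real.log_exp 1]
    exact Real.log_le_log (Real.exp_pos 1) (by linarith [Real.exp_one_lt_three])
  have hr1 : 0 ≤ Real.log (Real.log (H : ℝ)) / Real.log (H : ℝ) :=
    div_nonneg (Real.log_nonneg hlogH1) (by linarith)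
  have hr2 : 0 ≤ 1 / Real.log (N : ℝ) ^ (1 / 700 : ℝ) :=
    div_nonneg zero_le_one (Real.rpow_nonneg (Real.log_natCast_nonneg N) _)
  have hI' : ∑ m ∈ range N, ‖∑ i ∈ range H,
      ((ArithmeticFunction.liouville (m + 1 + i) : ℤ) : ℂ) * VdC.e (α * ((m + 1 + i : ℕ) : ℝ))‖
      ≤ C' * (2 * η) * H * N := by
    refine hI.trans ?_
    have hHN0 : 0 ≤ (H : ℝ) * N := by positivity
    calc C * (Real.log (Real.log H) / Real.log H + 1 / (Real.log N) ^ (1 / 700 : ℝ)) * H * N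
        = C * ((Real.log (Real.log H) / Real.log H + 1 / (Real.log N) ^ (1 / 700 : ℝ)) * (H * N)) := by
          ring
      _ ≤ C' * ((2 * η) * (H * N)) :=
          mul_le_mul hCC' (mul_le_mul_of_nonneg_right (by linarith) hHN0) (by positivity)
            (by linarith)
      _ = C' * (2 * η) * H * N := by ring
  -- blocks versus windows
  have hcomb := sum_blocks_le
    (F := fun m => ((ArithmeticFunction.liouville m : ℤ) : ℂ) * VdC.e (α * m))
    (fun m => norm_liouville_mul_e_le α m) hJH B
  rw [hHB] at hcomb
  -- bookkeeping: `J H ≤ J δ' N / 4`, `2 J² B ≤ J δ' N / 4`, `C' 2η H N ≤ J δ' N / 2`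
  have h1 : (J : ℝ) * H ≤ J * (δ' * N) / 4 := by
    have h4H : 4 * (H : ℝ) ≤ δ' * N := by
      rw [div_le_iff₀ hδ'0] at hnδ; linarith
    nlinarith [hJpos.le]
  have h2 : 2 * (J : ℝ) ^ 2 * B ≤ J * (δ' * N) / 4 := by
    have hB0 : (0 : ℝ) ≤ B := Nat.cast_nonneg B
    have h2a : 2 * (J : ℝ) * B ≤ δ' * N / 4 := by
      have := mul_le_mul_of_nonneg_right hJle hB0
      rw [← hBreal]; linarith
    have := mul_le_mul_of_nonneg_left h2a hJpos.le
    linarith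
  have h3 : C' * (2 * η) * H * N ≤ J * (δ' * N) / 2 := by
    have hC'0 : (0 : ℝ) < C' := by linarith
    have hcoef : C' * (2 * η) = δ' ^ 2 / 32 := by
      rw [hη]; field_simp; ring
    rw [hcoef]
    have := mul_le_mul_of_nonneg_right hJge (by positivity : (0 : ℝ) ≤ δ' * N / 2)
    linarith
  -- conclusion: `S ≤ δ' N ≤ δ 2^n`
  rw [← hNreal]
  refine le_trans ?_ (mul_le_mul_of_nonneg_right hδ'δ hN0)
  refine le_of_mul_le_mul_left ?_ hJpos
  linarith [hcomb, hI', h1, h2, h3]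

end Summit.QuantumAdvantage.QuantumAdvantage.Theorems.MobiusLadderQuadraticDigitPhasesStubMomoAPBlocks
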